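import Literature.NumberTheory.Automorphic.ArchEndoscopicChartOrbLocal      -- ★ p850124 FILE D2 (LH3-p03 (g3)): `chartOrbHLoc`, `chartHaarHLoc`, `chartBoxImgLoc`, Haar-freeness `chartOrbHLoc_eq_of_isHaarMeasure`
import HarnessLib

/-!
# The local chart orbital functional `chartOrbHLoc L S w` depends on the Cartan label `S` only through `w ∈ S`
# ((PROD-QUOT-H) companion of FILE D2 — Rogawski 1990 §8.2; Shelstad 1979 §4; Deitmar–Echterhoff 2014 Thm. 1.5.3; Folland 1995 §2.6)

Topic `NumberTheory/Automorphic`; namespace `Literature.NumberTheory.Automorphic.UnitaryGroup`.  THEOREMS ONLY (no `def`, no instance, no notation, no axiom, no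
`sorry`).  Cell `pub/hodgecm-mathlib`, crux H413 (`stmt-HodgeConjecture-24833`), F0∕P3c line LH3 (closer stub `stub_N9`, DIRECT ROAD), organ J; brick **(T-CONGR)**
of the (J-H) docking (LH10-p02 (g4)).  Count-neutral.

WHY.  The (J-H) jump of the genuine stable family `stOrbFamH L νH fH S` at the wall `w₀ ∉ S` is read (★ `ArchBouazizStableFamilyJumpZero`, product road (P1)
★ `chartOrbH_eq_prod_chartOrbHLoc`) as `G(s) · ∏_{w ≠ w₀} L_w[chartOrbHLoc L S w] · (jump of the w₀-factor)`, while the Cayley value on the ADJACENT split chart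
`S′ = insert w₀ S` (★ `ArchBouazizStableFamilyCayleyValue`) reads `G(s) · ∏_{w ≠ w₀} L_w[chartOrbHLoc L S′ w] · ℓ₀`.  The jump constant `jcH S w₀ = jump ∕ value` is uniform
in the wall point and the test function ONLY because the spectator functionals of the two charts COINCIDE at every place `w ≠ w₀`: the local chart data at `w`
(local chart `endoBlockAt L S w`, local torus `T_{S,w}`, local box, hence the normalised quotient functional) read the label `S` only through the bit `w ∈ S`.
This file proves exactly that: **`chartOrbHLoc_eq_of_mem_iff : (w ∈ S ↔ w ∈ S′) → chartOrbHLoc L S w ν_w f cw = chartOrbHLoc L S′ w ν_w f cw`**, with the corollaries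
`chartOrbHLoc_insert_of_ne` ∕ `chartOrbHLoc_erase_of_ne`.

HOW.  §1 is generic measure theory: the normalised quotient orbital functional `t(e(B)) · ∫_{G⧸T} F(y γ y⁻¹) d(ν∕t)` is RIGID — it does not change when the data
`(T, e, B, γ, t)` are replaced by propositionally equal data and ANY other inversion-invariant Haar measure `t′` of the (equal) torus (Haar uniqueness `t′ = κ • t` and
★ `quotientMeasure_eq_inv_smul_of_eq_smul`: `ν∕(κ•t) = κ⁻¹ • ν∕t`, the prefactor absorbs `κ` — Deitmar–Echterhoff Thm. 1.5.3, Folland (2.52)); stated with the equal data as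
SEPARATE variables so that the dependent types (`Measure ↥T` vs `Measure ↥T′`, membership proofs) never have to be rewritten.  §2 checks that the local data of ★ FILE D1∕D2 at
`w` agree for two labels with `w ∈ S ↔ w ∈ S′` (`endoBlock`, `endoBlockAt`, `chartTorusHLoc`, `chartBoxLoc` — each by unfolding one `if w ∈ S`), and §3 assembles the head through
★ Haar-freeness `chartOrbHLoc_eq_of_isHaarMeasure`.
HONEST LABEL: HC_CM is proved only modulo the 7 printed citations (2 remaining: hLiu418 = `stmt-HodgeConjecture-24832`, h413 = `stmt-HodgeConjecture-24833`) until rung 0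
closes; measure-theoretic bookkeeping, moves no row of the books.

## References
* [Rogawski1990] J. D. Rogawski, *Automorphic Representations of Unitary Groups in Three Variables*, Ann. of Math. Stud. 123 (1990), §3.6 p. 31, §8.2 p. 122, §8.3 p. 124.
* [Shelstad1979] D. Shelstad, *Characters and inner forms of a quasi-split group over ℝ*, Compositio Math. 39 (1979), §4 pp. 22–23 (`T`, `dt`, `Φ^T_f`).
* [DeitmarEchterhoff2014] A. Deitmar, S. Echterhoff, *Principles of Harmonic Analysis*, 2nd ed. (2014), Thm. 1.5.3, Cor. 1.5.4.
* [Folland1995] G. B. Folland, *A Course in Abstract Harmonic Analysis* (1995), §2.2, §2.6 Thm. 2.49, (2.52).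
-/

set_option autoImplicit false

noncomputable section

open MeasureTheory MeasureTheory.Measure NumberField NumberField.InfinitePlace Matrix Complex Topology
open Literature.MeasureTheory.Group
open scoped MatrixGroups Matrix Classical ENNReal NNReal

namespace Literature.NumberTheory.Automorphic.UnitaryGroup

/-! ## §1 Generic: the normalised quotient orbital functional is rigid under equal data and Haar-free -/

section Generic

/-- **RIGIDITY OF THE NORMALISED QUOTIENT ORBITAL FUNCTIONAL.**  For a closed subgroup `T ≤ G` (unimodular setting: `ν` a Haar measure on `G`, `t` an inversion-invariant
Haar measure on `T`), a map `e : X → T` with box `B ⊆ X`, an element `γ` centralised by `T` and a test function `F`, the number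
`t(e(B)) · ∫_{G⧸T} F(y γ y⁻¹) d(ν∕t)(ȳ)` does not change when `(e, B, T, γ)` are replaced by EQUAL data and `t` by ANY inversion-invariant Haar measure `t′` of the torus:
Haar uniqueness `t′ = κ • t` on `T` and `ν∕(κ • t) = κ⁻¹ • (ν∕t)` (★ `quotientMeasure_eq_inv_smul_of_eq_smul`), the prefactor absorbing `κ`.  (The equal data enter as separate
variables: the two sides live over `Measure ↥T`, `Measure ↥T′` and carry their own membership proofs.) [cite: DeitmarEchterhoff2014, Thm. 1.5.3; Cor. 1.5.4]
[cite: Folland1995, §2.6 Thm. 2.49, (2.52)] -/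
theorem toReal_mul_integral_descConj_quotientMeasure_eq_of_eq
    {G : Type*} [Group G] [TopologicalSpace G] [IsTopologicalGroup G] [LocallyCompactSpace G] [SecondCountableTopology G] [T2Space G]
    [MeasurableSpace G] [BorelSpace G] (ν : Measure G) [ν.IsHaarMeasure] [ν.IsMulRightInvariant]
    {X : Type*} {e e' : X → G} (hee' : e = e') {B B' : Set X} (hBB' : B = B')
    {T T' : Subgroup G} (hTT' : T = T') (hT : IsClosed (T : Set G)) (hT' : IsClosed (T' : Set G))
    (he : ∀ x, e x ∈ T) (he' : ∀ x, e' x ∈ T')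
    {γ γ' : G} (hγγ' : γ = γ') (hγ : ∀ m ∈ T, m * γ = γ * m) (hγ' : ∀ m ∈ T', m * γ' = γ' * m) (F : G → ℂ)
    (t : Measure ↥T) [t.IsHaarMeasure] [t.IsInvInvariant] (t' : Measure ↥T') [t'.IsHaarMeasure] [t'.IsInvInvariant] :
    (letI : MeasurableSpace (G ⧸ T) := borel _
     haveI : BorelSpace (G ⧸ T) := ⟨rfl⟩
     ((t ((fun x => (⟨e x, he x⟩ : ↥T)) '' B)).toReal : ℂ) * ∫ y, descConj γ T hγ F y ∂(quotientMeasure T t hT ν)) =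
    (letI : MeasurableSpace (G ⧸ T') := borel _
     haveI : BorelSpace (G ⧸ T') := ⟨rfl⟩
     ((t' ((fun x => (⟨e' x, he' x⟩ : ↥T')) '' B')).toReal : ℂ) * ∫ y, descConj γ' T' hγ' F y ∂(quotientMeasure T' t' hT' ν)) := by
  subst hee' hBB' hTT' hγγ'
  letI : MeasurableSpace (G ⧸ T) := borel _
  haveI : BorelSpace (G ⧸ T) := ⟨rfl⟩
  haveI : LocallyCompactSpace ↥T := hT.isClosedEmbedding_subtypeVal.locallyCompactSpace
  -- the two membership ∕ closedness ∕ commutation proofs are irrelevant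
  change ((t ((fun x => (⟨e x, he x⟩ : ↥T)) '' B)).toReal : ℂ) * ∫ y, descConj γ T hγ F y ∂(quotientMeasure T t hT ν) =
    ((t' ((fun x => (⟨e x, he x⟩ : ↥T)) '' B)).toReal : ℂ) * ∫ y, descConj γ T hγ F y ∂(quotientMeasure T t' hT ν)
  -- Haar uniqueness on `T`: `t' = κ • t`, and the quotient measure scales inversely
  set κ : ℝ≥0 := haarScalarFactor t' t with hκdef
  have hκ : κ ≠ 0 := (haarScalarFactor_pos_of_isHaarMeasure t' t).ne'
  have ht : t' = κ • t := isMulLeftInvariant_eq_smul t' t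
  have hQ := quotientMeasure_eq_inv_smul_of_eq_smul T hT t t' ν hκ ht
  rw [hQ, integral_smul_nnreal_measure, ht, Measure.smul_apply, ENNReal.smul_def, smul_eq_mul, ENNReal.toReal_mul, ENNReal.coe_toReal,
    NNReal.smul_def, Complex.real_smul, NNReal.coe_inv, Complex.ofReal_mul, Complex.ofReal_inv]
  have hκC : ((κ : ℝ) : ℂ) ≠ 0 := by exact_mod_cast hκ
  field_simp

end Generic

/-! ## §2 The local chart data at `w` read the label `S` only through `w ∈ S` -/

section LocalData

variable (L : Type) [Field L] (w : {w : InfinitePlace L // IsComplex w}) {S S' : Finset {w : InfinitePlace L // IsComplex w}}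

/-- The `U(Φ₂)_w`-component of the chart reads `S` only through `w ∈ S` (one `if w ∈ S` in ★ `endoBlock`). [cite: Rogawski1990, §3.6 p. 31; §8.2 p. 122] -/
theorem endoBlock_eq_of_mem_iff (h : w ∈ S ↔ w ∈ S') (c : {w : InfinitePlace L // IsComplex w} → Fin 3 → ℝ) :
    endoBlock L S c w = endoBlock L S' c w := by
  unfold endoBlock
  by_cases hw : w ∈ S
  · rw [if_pos hw, if_pos (h.1 hw)]
  · rw [if_neg hw, if_neg (fun h' => hw (h.2 h'))]

/-- The local chart `endoBlockAt L S w` reads `S` only through `w ∈ S`. [cite: Rogawski1990, §3.6 p. 31; §8.2 p. 122] -/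
theorem endoBlockAt_eq_of_mem_iff (h : w ∈ S ↔ w ∈ S') : endoBlockAt L S w = endoBlockAt L S' w :=
  funext fun cw => endoBlock_eq_of_mem_iff L w h (fun _ => cw)

/-- The local chart torus `T_{S,w}` reads `S` only through `w ∈ S`. [cite: Shelstad1979, §4 p. 22] [cite: Rogawski1990, §3.6 p. 31] -/
theorem chartTorusHLoc_eq_of_mem_iff (h : w ∈ S ↔ w ∈ S') : chartTorusHLoc L S w = chartTorusHLoc L S' w := by
  have hr : (endoBlockAtHom L S w).range = (endoBlockAtHom L S' w).range := by
    ext g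
    simp only [MonoidHom.mem_range, endoBlockAtHom_apply, endoBlockAt_eq_of_mem_iff L w h]
  unfold chartTorusHLoc
  rw [hr]

/-- The local coordinate box reads `S` only through `w ∈ S`. [cite: Folland1995, §2.2] [cite: Rogawski1990, §8.2 p. 122] -/
theorem chartBoxLoc_eq_of_mem_iff (h : w ∈ S ↔ w ∈ S') : chartBoxLoc L S w = chartBoxLoc L S' w := by
  unfold chartBoxLoc
  by_cases hw : w ∈ S
  · have hw' : w ∈ S' := h.1 hw
    simp only [hw, hw', true_and]
  · have hw' : w ∉ S' := fun h' => hw (h.2 h')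
    simp only [hw, hw', false_and]

end LocalData

/-! ## §3 The head: `chartOrbHLoc L S w = chartOrbHLoc L S′ w` whenever `w ∈ S ↔ w ∈ S′` -/

section Head

variable (L : Type) [Field L] (w : {w : InfinitePlace L // IsComplex w}) {S S' : Finset {w : InfinitePlace L // IsComplex w}}
  [MeasurableSpace ↥(archLocal L 2 (Matrix.of fun i j : Fin 2 => if i.val + j.val + 1 = 2 then (1 : L) else 0) w)]
  [BorelSpace ↥(archLocal L 2 (Matrix.of fun i j : Fin 2 => if i.val + j.val + 1 = 2 then (1 : L) else 0) w)]
  (νw : Measure ↥(archLocal L 2 (Matrix.of fun i j : Fin 2 => if i.val + j.val + 1 = 2 then (1 : L) else 0) w)) [νw.IsHaarMeasure] [νw.IsMulRightInvariant]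

/-- **(T-CONGR) THE LOCAL CHART ORBITAL FUNCTIONAL READS THE LABEL `S` ONLY THROUGH `w ∈ S`**: if `w ∈ S ↔ w ∈ S′` then
`chartOrbHLoc L S w ν_w f cw = chartOrbHLoc L S′ w ν_w f cw` for every `f` and every local coordinate `cw` (no measurability, no regularity hypothesis).
The local chart, torus and box coincide (§2); the auxiliary Haar measures `dt_w` of the (equal) tori may differ, which ★ Haar-freeness and §1 absorb.  In particular the
spectator functionals of the charts `S` and `insert w₀ S` agree at every `w ≠ w₀` — what makes the Bouaziz jump constant `jcH S w₀ = jump ∕ Cayley value` independent of the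
wall point and of the test function. [cite: Rogawski1990, §8.2 p. 122; §8.3 p. 124] [cite: Shelstad1979, §4 pp. 22–23] [cite: DeitmarEchterhoff2014, Thm. 1.5.3]
[cite: Folland1995, §2.6 (2.52)] -/
theorem chartOrbHLoc_eq_of_mem_iff (h : w ∈ S ↔ w ∈ S')
    (f : ↥(archLocal L 2 (Matrix.of fun i j : Fin 2 => if i.val + j.val + 1 = 2 then (1 : L) else 0) w) → ℂ) (cw : Fin 3 → ℝ) :
    chartOrbHLoc L S w νw f cw = chartOrbHLoc L S' w νw f cw := by
  haveI := locallyCompactSpace_archLocal_two L w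
  haveI := secondCountableTopology_archLocal_two L w
  haveI := locallyCompactSpace_chartTorusHLoc L S w
  haveI := locallyCompactSpace_chartTorusHLoc L S' w
  haveI := isHaarMeasure_chartHaarHLoc L S w
  haveI := isInvInvariant_chartHaarHLoc L S w
  haveI := isHaarMeasure_chartHaarHLoc L S' w
  haveI := isInvInvariant_chartHaarHLoc L S' w
  rw [chartOrbHLoc_eq_of_isHaarMeasure L S w νw (chartHaarHLoc L S w) f cw,
    chartOrbHLoc_eq_of_isHaarMeasure L S' w νw (chartHaarHLoc L S' w) f cw]
  exact toReal_mul_integral_descConj_quotientMeasure_eq_of_eq νw (endoBlockAt_eq_of_mem_iff L w h) (chartBoxLoc_eq_of_mem_iff L w h)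
    (chartTorusHLoc_eq_of_mem_iff L w h) (isClosed_chartTorusHLoc L S w) (isClosed_chartTorusHLoc L S' w)
    (endoBlockAt_mem_chartTorusHLoc L S w) (endoBlockAt_mem_chartTorusHLoc L S' w)
    (congrFun (endoBlockAt_eq_of_mem_iff L w h) cw) (forall_mem_chartTorusHLoc_comm L S w cw) (forall_mem_chartTorusHLoc_comm L S' w cw) f
    (chartHaarHLoc L S w) (chartHaarHLoc L S' w)

/-- **The spectator functionals of `S` and `insert w₀ S` agree at every `w ≠ w₀`.** [cite: Rogawski1990, §8.2 p. 122] [cite: Shelstad1979, §4 pp. 22–23] -/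
theorem chartOrbHLoc_insert_of_ne {w₀ : {w : InfinitePlace L // IsComplex w}} (hne : w ≠ w₀) (S : Finset {w : InfinitePlace L // IsComplex w})
    (f : ↥(archLocal L 2 (Matrix.of fun i j : Fin 2 => if i.val + j.val + 1 = 2 then (1 : L) else 0) w) → ℂ) (cw : Fin 3 → ℝ) :
    chartOrbHLoc L (insert w₀ S) w νw f cw = chartOrbHLoc L S w νw f cw :=
  chartOrbHLoc_eq_of_mem_iff L w νw (by rw [Finset.mem_insert, or_iff_right hne]) f cw

/-- **The spectator functionals of `S` and `S.erase w₀` agree at every `w ≠ w₀`.** [cite: Rogawski1990, §8.2 p. 122] [cite: Shelstad1979, §4 pp. 22–23] -/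
theorem chartOrbHLoc_erase_of_ne {w₀ : {w : InfinitePlace L // IsComplex w}} (hne : w ≠ w₀) (S : Finset {w : InfinitePlace L // IsComplex w})
    (f : ↥(archLocal L 2 (Matrix.of fun i j : Fin 2 => if i.val + j.val + 1 = 2 then (1 : L) else 0) w) → ℂ) (cw : Fin 3 → ℝ) :
    chartOrbHLoc L (S.erase w₀) w νw f cw = chartOrbHLoc L S w νw f cw :=
  chartOrbHLoc_eq_of_mem_iff L w νw (by rw [Finset.mem_erase, and_iff_right hne]) f cw

end Head

end Literature.NumberTheory.Automorphic.UnitaryGroup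

end
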